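import Summits.ABC.ABC.Theorems.TwistAmplificationSharpModerateLawPlanarityFactorisationRing

/-!
# Crux `TwistAmplification.SharpModerateLaw` (stmt-ABC-1975), line `unit-plane-conic-two-torsion`:
the LOCAL LEMMA of the lever `stub_planarityFactorisation`

Second helper file of the stub `stub_planarityFactorisation : PlanarityFactorisation` (after
`…PlanarityFactorisationRing.lean`: `O = R(F)` is a Dedekind domain for irreducible maximal `F`,
`N(a u + v ω) = a² F(u, v)`, `liftHom`).  Kane's factorisation step (arXiv:1104.2635, Prop. 9) transplanted to
the maximal cubic order needs the primes of `O` through the plane element `a u + v ω`; this file proves that away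
from `a` they have DEGREE ONE:

* `primeIdealAt F q c = (q, ω + c)` and the SHAPE ROOTS `shapeRoots F q = {c < q : χ(−c) ≡ 0 (mod q)}`,
  `χ(W) = W³ − bW² + acW − a²d` the cubic satisfied by `ω`; at most three of them for a prime `q`
  (`card_shapeRoots_le_three`, registered sub-goal);
* every element of `O` is congruent to an integer modulo `(q, ω + c)` when `a` is invertible mod `q`
  (`exists_int_sub_mem_primeIdealAt`: `ω ≡ −c`, `aθ = −ac + bω − ω²`), so `#(O/(q, ω + c)) ≤ q`;
* `(q, ω + c) ≠ ⊤` for a prime `q ∤ a` and a shape root `c`: the ring map `O → ℤ/q`, `ω ↦ w = −c`,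
  `θ ↦ a⁻¹(−ac + bw − w²)` kills it (`primeIdealAt_ne_top`; the table relations reduce to `χ(w) = 0`);
* hence `N(q, ω + c) = q`, the ideal is prime, and it is the only prime ideal above it
  (`absNorm_primeIdealAt`, `isPrime_primeIdealAt`, `eq_primeIdealAt_of_le`);
* for coprime `(u, v)` and a prime `q ∤ a` dividing `F(u, v)`: `q ∤ v`, the residue `c = a u v⁻¹ (mod q)`
  (`residueAt`) is a shape root (`v³χ(−au/v) = −a²F(u, v)`), and `(q, ω + c) = (q, a u + v ω)`
  (`planeElt_mem_primeIdealAt`, `primeIdealAt_le_span_pair`, `eq_primeIdealAt_of_mem`); in closed form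
  `exists_degree_one_prime` (registered sub-goal): the prime `(q, a u + v ω)` has `q` residue classes.
-/

noncomputable section

-- the mandated summit namespace `Summit.ABC.ABC` (summit = problem) trips the duplicate-namespace linter
set_option linter.dupNamespace false

namespace Summit.ABC.ABC.Theorems.SharpModerateLaw.UnitPlane

open Literature.NumberTheory.CubicFields
open RingOfForm (omega theta RatAlgebra)

/-! ## 1. The ideals `(q, ω + c)` and the shape roots -/

section Local

variable (F : BinaryCubic ℤ)

/-- The ideal `𝔓(q, c) = (q, ω + c)` of `R(F)`. -/
def primeIdealAt (q c : ℕ) : Ideal (RingOfForm F) :=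
  Ideal.span {(q : RingOfForm F), omega F + (c : RingOfForm F)}

/-- The SHAPE ROOTS at `q`: residues `c ∈ [0, q)` with `χ(−c) = 0` in `ℤ/q`, where
`χ(W) = W³ − bW² + acW − a²d` (the residues for which `(q, ω + c)` can be a proper ideal; at most three
of them for a prime `q`). -/
def shapeRoots (q : ℕ) : Finset ℕ :=
  (Finset.range q).filter fun c =>
    (-(c : ZMod q)) ^ 3 - (F.b : ZMod q) * (-(c : ZMod q)) ^ 2 + (F.a : ZMod q) * F.c * (-(c : ZMod q))
      - (F.a : ZMod q) ^ 2 * F.d = 0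

variable {F} in
/-- Membership in `shapeRoots`. -/
theorem mem_shapeRoots {q c : ℕ} : c ∈ shapeRoots F q ↔ c < q ∧
    (-(c : ZMod q)) ^ 3 - (F.b : ZMod q) * (-(c : ZMod q)) ^ 2 + (F.a : ZMod q) * F.c * (-(c : ZMod q))
      - (F.a : ZMod q) ^ 2 * F.d = 0 := by
  rw [shapeRoots, Finset.mem_filter, Finset.mem_range]

variable {F}

/-- `q ∈ 𝔓(q, c)`. -/
theorem natCast_mem_primeIdealAt (q c : ℕ) : (q : RingOfForm F) ∈ primeIdealAt F q c :=
  Ideal.subset_span (by simp)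

/-- `ω + c ∈ 𝔓(q, c)`. -/
theorem omega_add_mem_primeIdealAt (q c : ℕ) : omega F + (c : RingOfForm F) ∈ primeIdealAt F q c :=
  Ideal.subset_span (by simp)

/-- `𝔓(q, c) ≠ ⊥` for `q ≠ 0`. -/
theorem primeIdealAt_ne_bot {q : ℕ} (hq : q ≠ 0) (c : ℕ) : primeIdealAt F q c ≠ ⊥ := by
  intro h
  have hmem := natCast_mem_primeIdealAt (F := F) q c
  rw [h, Ideal.mem_bot] at hmem
  exact hq (by simpa using congrArg RingOfForm.x hmem)

/-- **Every element of `O` is congruent to an integer modulo `(q, ω + c)`** when `a` is invertible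
mod `q`: `ω ≡ −c` and `θ = a'·(aθ) + (1 − aa')θ ≡ a'(−ac − bc − c²)` (`aθ = −ac + bω − ω²`). -/
theorem exists_int_sub_mem_primeIdealAt {q : ℕ} (hcop : IsCoprime F.a (q : ℤ)) (c : ℕ) (y : RingOfForm F) :
    ∃ n : ℤ, y - (n : RingOfForm F) ∈ primeIdealAt F q c := by
  obtain ⟨s, t, hst⟩ := hcop
  set I := primeIdealAt F q c
  let π := Ideal.Quotient.mk I
  have hq : π (q : RingOfForm F) = 0 := Ideal.Quotient.eq_zero_iff_mem.mpr (natCast_mem_primeIdealAt q c)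
  have hω : π (omega F) = -(π (c : RingOfForm F)) :=
    eq_neg_of_add_eq_zero_left (by rw [← map_add]; exact Ideal.Quotient.eq_zero_iff_mem.mpr (omega_add_mem_primeIdealAt q c))
  have hsa : π (s : RingOfForm F) * π (F.a : RingOfForm F) = 1 := by
    have h1 : (s : RingOfForm F) * (F.a : RingOfForm F) + (t : RingOfForm F) * (q : RingOfForm F) = 1 := by
      have h := congrArg (Int.cast : ℤ → RingOfForm F) hst
      push_cast at h
      exact h
    have h2 := congrArg π h1
    rwa [map_add, map_mul, map_mul, map_one, hq, mul_zero, add_zero] at h2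
  have hθa : π (F.a : RingOfForm F) * π (theta F) =
      -(π (F.a : RingOfForm F) * π (F.c : RingOfForm F)) + π (F.b : RingOfForm F) * π (omega F) - π (omega F) * π (omega F) := by
    have h := congrArg π (RingOfForm.omega_sq (f := F))
    simp only [map_mul, map_add, map_sub, Int.cast_neg, Int.cast_mul, map_neg] at h
    linear_combination h
  -- `θ ≡ s·(−ac − bc − c²)`
  set nθ : ℤ := s * (-(F.a * F.c) - F.b * c - (c : ℤ) ^ 2) with hnθ
  have hθ : π (theta F) = π (nθ : RingOfForm F) := by
    have : π (theta F) = π (s : RingOfForm F) * (π (F.a : RingOfForm F) * π (theta F)) := by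
      rw [← mul_assoc, hsa, one_mul]
    rw [this, hθa, hω, hnθ]
    simp only [Int.cast_mul, Int.cast_sub, Int.cast_neg, Int.cast_pow, Int.cast_natCast, map_mul, map_sub, map_neg,
      map_pow, map_natCast, map_intCast]
    ring
  refine ⟨y.x - y.y * c + y.z * nθ, ?_⟩
  rw [← Ideal.Quotient.eq]
  conv_lhs => rw [RingOfForm.eq_coord_combination y]
  change π _ = π _
  simp only [map_add, map_mul, hθ, hω, Int.cast_add, Int.cast_sub, Int.cast_mul, Int.cast_natCast, map_sub]
  ring

/-- For `0 < q` and `a` invertible mod `q`, `O/(q, ω + c)` has at most `q` elements. -/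
theorem card_quot_primeIdealAt_le {q : ℕ} (hq : 0 < q) (hcop : IsCoprime F.a (q : ℤ)) (c : ℕ) :
    Nat.card (RingOfForm F ⧸ primeIdealAt F q c) ≤ q := by
  haveI : NeZero q := ⟨hq.ne'⟩
  set I := primeIdealAt F q c
  let g : ZMod q → RingOfForm F ⧸ I := fun z => Ideal.Quotient.mk I ((z.val : ℤ) : RingOfForm F)
  have hg : Function.Surjective g := by
    intro Y
    obtain ⟨y, rfl⟩ := Ideal.Quotient.mk_surjective Y
    obtain ⟨n, hn⟩ := exists_int_sub_mem_primeIdealAt hcop c y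
    refine ⟨(n : ZMod q), ?_⟩
    simp only [g, ZMod.val_intCast]
    rw [Ideal.Quotient.eq]
    have hdiv : (n % q : ℤ) = n - q * (n / q) := Int.emod_def n q
    have hmem : ((n % q : ℤ) : RingOfForm F) - (n : RingOfForm F) ∈ I := by
      rw [hdiv]
      have : ((n - q * (n / q) : ℤ) : RingOfForm F) - (n : RingOfForm F) =
          (q : RingOfForm F) * (((-(n / q)) : ℤ) : RingOfForm F) := by
        push_cast; ring
      rw [this]
      exact I.mul_mem_right _ (natCast_mem_primeIdealAt q c)
    convert I.sub_mem hmem hn using 1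
    ring
  calc Nat.card (RingOfForm F ⧸ I) ≤ Nat.card (ZMod q) := Nat.card_le_card_of_surjective g hg
    _ = q := Nat.card_zmod q

/-- **`(q, ω + c)` is proper** when `q ∤ a` is prime and `χ(−c) = 0 (mod q)`: the ring map
`O → ℤ/q`, `ω ↦ w = −c`, `θ ↦ t = a⁻¹(−ac + bw − w²)` kills it (the table relations for `(w, t)`
reduce to `χ(w) = 0`: `wt + ad = −a⁻¹χ(w)`, `a²(t² + bd − dw + ct) = (w − b)χ(w)`). -/
theorem primeIdealAt_ne_top {q : ℕ} (hq : q.Prime) (hqa : ¬ (q : ℤ) ∣ F.a) {c : ℕ} (hroot : c ∈ shapeRoots F q) :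
    primeIdealAt F q c ≠ ⊤ := by
  haveI : Fact q.Prime := ⟨hq⟩
  have ha : (F.a : ZMod q) ≠ 0 := by rwa [Ne, ZMod.intCast_zmod_eq_zero_iff_dvd]
  set w : ZMod q := -(c : ZMod q) with hw
  set ai : ZMod q := (F.a : ZMod q)⁻¹ with hai
  have ha1 : (F.a : ZMod q) * ai = 1 := mul_inv_cancel₀ ha
  set t : ZMod q := ai * (-((F.a : ZMod q) * F.c) + (F.b : ZMod q) * w - w ^ 2) with ht
  have hχ : w ^ 3 - (F.b : ZMod q) * w ^ 2 + (F.a : ZMod q) * F.c * w - (F.a : ZMod q) ^ 2 * F.d = 0 :=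
    (mem_shapeRoots.mp hroot).2
  have hwt : w * t = -((F.a : ZMod q) * F.d) := by
    rw [ht]; linear_combination (-ai) * hχ + (-((F.a : ZMod q) * F.d)) * ha1
  have hww : w * w = -((F.a : ZMod q) * F.c) + (F.b : ZMod q) * w - (F.a : ZMod q) * t := by
    rw [ht]; linear_combination (-((F.a : ZMod q) * F.c) + (F.b : ZMod q) * w - w ^ 2) * ha1
  have htt : t * t = -((F.b : ZMod q) * F.d) + (F.d : ZMod q) * w - (F.c : ZMod q) * t := by
    rw [ht]
    linear_combination (ai ^ 2 * (w - F.b)) * hχ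
      + (-((F.c : ZMod q) * (-((F.a : ZMod q) * F.c) + (F.b : ZMod q) * w - w ^ 2) * ai
          + ((F.b : ZMod q) * F.d - (F.d : ZMod q) * w) * ((F.a : ZMod q) * ai + 1))) * ha1
  let ψ := liftHom F w t hwt hww htt
  intro htop
  have hle : primeIdealAt F q c ≤ RingHom.ker ψ := by
    rw [primeIdealAt, Ideal.span_le]
    rintro x (rfl | rfl)
    · simp [ψ]
    · rw [SetLike.mem_coe, RingHom.mem_ker, map_add, map_natCast]
      change liftHom F w t hwt hww htt (omega F) + (c : ZMod q) = 0
      rw [liftHom_omega, hw, neg_add_cancel]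
  rw [htop, top_le_iff] at hle
  exact RingHom.ker_ne_top ψ hle

/-- A prime `q ∤ a` is coprime to `a`. -/
theorem isCoprime_a_of_not_dvd {q : ℕ} (hq : q.Prime) (hqa : ¬ (q : ℤ) ∣ F.a) : IsCoprime F.a (q : ℤ) :=
  ((Nat.prime_iff_prime_int.mp hq).irreducible.coprime_iff_not_dvd.mpr hqa).symm

variable [hF : Fact F.IsIrreducible] [hM : Fact (RingOfForm.IsMaximal F)]

/-- **`N(q, ω + c) = q`** for a prime `q ∤ a` and a root `c` of `χ(−·) (mod q)`: the norm divides
`N(q) = q³`, is `≤ q` (`card_quot_primeIdealAt_le`) and is not `1` (`primeIdealAt_ne_top`). -/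
theorem absNorm_primeIdealAt {q : ℕ} (hq : q.Prime) (hqa : ¬ (q : ℤ) ∣ F.a) {c : ℕ} (hroot : c ∈ shapeRoots F q) :
    Ideal.absNorm (primeIdealAt F q c) = q := by
  set I := primeIdealAt F q c
  have hdvd : Ideal.absNorm I ∣ q ^ 3 := by
    have h : Ideal.absNorm I ∣ Ideal.absNorm (Ideal.span {(q : RingOfForm F)}) :=
      Ideal.absNorm_dvd_absNorm_of_le ((Ideal.span_singleton_le_iff_mem _).mpr (natCast_mem_primeIdealAt q c))
    rwa [Ideal.absNorm_span_natCast, RingOfForm.finrank_eq_three] at h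
  have hne1 : Ideal.absNorm I ≠ 1 := by
    rw [Ne, Ideal.absNorm_eq_one_iff]
    exact primeIdealAt_ne_top hq hqa hroot
  have hle : Ideal.absNorm I ≤ q := by
    rw [Ideal.absNorm_apply, Submodule.cardQuot_apply]
    exact card_quot_primeIdealAt_le hq.pos (isCoprime_a_of_not_dvd hq hqa) c
  obtain ⟨k, hk, hk'⟩ := (Nat.dvd_prime_pow hq).mp hdvd
  rw [hk'] at hne1 hle ⊢
  have hk0 : k ≠ 0 := fun h => hne1 (by rw [h, pow_zero])
  have hk1 : k ≤ 1 := by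
    by_contra h
    have h2 : q * q ≤ q ^ k := by rw [← pow_two]; exact Nat.pow_le_pow_right hq.pos (by omega)
    have h3 : q * 2 ≤ q * q := Nat.mul_le_mul_left q hq.two_le
    have h4 : q * q ≤ q := h2.trans hle
    have h5 := hq.two_le
    nlinarith
  rw [show k = 1 by omega, pow_one]

/-- **`(q, ω + c)` is a prime ideal** (its norm is the prime `q`). -/
theorem isPrime_primeIdealAt {q : ℕ} (hq : q.Prime) (hqa : ¬ (q : ℤ) ∣ F.a) {c : ℕ} (hroot : c ∈ shapeRoots F q) :
    (primeIdealAt F q c).IsPrime :=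
  Ideal.isPrime_of_irreducible_absNorm (by rw [absNorm_primeIdealAt hq hqa hroot]; exact hq)

/-- **Uniqueness**: `(q, ω + c)` is maximal, so it is the only prime ideal containing it. -/
theorem eq_primeIdealAt_of_le {q : ℕ} (hq : q.Prime) (hqa : ¬ (q : ℤ) ∣ F.a) {c : ℕ} (hroot : c ∈ shapeRoots F q)
    {P : Ideal (RingOfForm F)} (hP : P.IsPrime) (hle : primeIdealAt F q c ≤ P) : P = primeIdealAt F q c :=
  (((isPrime_primeIdealAt hq hqa hroot).isMaximal (primeIdealAt_ne_bot hq.ne_zero c)).eq_of_le hP.ne_top hle).symm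

end Local

/-! ## 2. The prime `(q, a u + v ω)` for `q ∣ F(u, v)`, `q ∤ a`, `(u, v)` coprime -/

section Plane

variable {F : BinaryCubic ℤ}

/-- A prime `q ∤ a` dividing `F(u, v)` at a coprime pair does not divide `v` (else `q ∣ a u³`). -/
theorem not_dvd_v_of_dvd_eval {q : ℕ} (hq : q.Prime) (hqa : ¬ (q : ℤ) ∣ F.a) {u v : ℤ} (huv : IsCoprime u v)
    (hqF : (q : ℤ) ∣ F.eval u v) : ¬ (q : ℤ) ∣ v := by
  intro hv
  have hq' : Prime (q : ℤ) := Nat.prime_iff_prime_int.mp hq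
  have h3 : (q : ℤ) ∣ F.a * u ^ 3 := by
    have : F.a * u ^ 3 = F.eval u v - v * (F.b * u ^ 2 + F.c * u * v + F.d * v ^ 2) := by
      rw [BinaryCubic.eval]; ring
    rw [this]
    exact dvd_sub hqF (dvd_mul_of_dvd_left hv _)
  rcases hq'.dvd_or_dvd h3 with h | h
  · exact hqa h
  · have hu : (q : ℤ) ∣ u := hq'.dvd_of_dvd_pow h
    exact hq'.not_unit (huv.isUnit_of_dvd' hu hv)

/-- The residue `c = a u · v⁻¹ (mod q) ∈ [0, q)` of the datum `(u, v)` at `q`. -/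
def residueAt (F : BinaryCubic ℤ) (u v : ℤ) (q : ℕ) : ℕ :=
  (((F.a * u : ℤ) : ZMod q) * ((v : ℤ) : ZMod q)⁻¹).val

/-- `residueAt F u v q < q`. -/
theorem residueAt_lt (F : BinaryCubic ℤ) (u v : ℤ) {q : ℕ} (hq : 0 < q) : residueAt F u v q < q := by
  haveI : NeZero q := ⟨hq.ne'⟩
  exact ZMod.val_lt _

variable {q : ℕ} (hq : q.Prime) (hqa : ¬ (q : ℤ) ∣ F.a) {u v : ℤ} (huv : IsCoprime u v) (hqF : (q : ℤ) ∣ F.eval u v)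
include hq hqa huv hqF

/-- In `ℤ/q`: `c · v = a u` for `c = residueAt F u v q`. -/
theorem residueAt_mul_v :
    ((residueAt F u v q : ℕ) : ZMod q) * ((v : ℤ) : ZMod q) = ((F.a * u : ℤ) : ZMod q) := by
  haveI : Fact q.Prime := ⟨hq⟩
  have hv : ((v : ℤ) : ZMod q) ≠ 0 := by
    rw [Ne, ZMod.intCast_zmod_eq_zero_iff_dvd]; exact not_dvd_v_of_dvd_eval hq hqa huv hqF
  rw [residueAt, ZMod.natCast_zmod_val, inv_mul_cancel_right₀ hv]

/-- **`c = a u v⁻¹` is a root of `χ(−·) (mod q)`**: `v³ χ(−au/v) = −a² F(u, v) ≡ 0`. -/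
theorem residueAt_mem_shapeRoots : residueAt F u v q ∈ shapeRoots F q := by
  haveI : Fact q.Prime := ⟨hq⟩
  have hv : ((v : ℤ) : ZMod q) ≠ 0 := by
    rw [Ne, ZMod.intCast_zmod_eq_zero_iff_dvd]; exact not_dvd_v_of_dvd_eval hq hqa huv hqF
  have hF0 : ((F.eval u v : ℤ) : ZMod q) = 0 := (ZMod.intCast_zmod_eq_zero_iff_dvd _ _).mpr hqF
  simp only [BinaryCubic.eval, Int.cast_add, Int.cast_mul, Int.cast_pow] at hF0
  have hc := residueAt_mul_v hq hqa huv hqF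
  push_cast at hc
  set w : ZMod q := -((residueAt F u v q : ℕ) : ZMod q) with hw
  have hwv : w * (v : ZMod q) = -((F.a : ZMod q) * u) := by rw [hw, neg_mul, hc]
  rw [mem_shapeRoots, ← hw]
  refine ⟨residueAt_lt F u v hq.pos, ?_⟩
  have key : (w ^ 3 - (F.b : ZMod q) * w ^ 2 + (F.a : ZMod q) * F.c * w - (F.a : ZMod q) ^ 2 * F.d) * (v : ZMod q) ^ 3 = 0 := by
    linear_combination ((w * v) ^ 2 + (w * v) * (-((F.a : ZMod q) * u)) + (-((F.a : ZMod q) * u)) ^ 2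
        - (F.b : ZMod q) * v * (w * v + -((F.a : ZMod q) * u)) + (F.a : ZMod q) * F.c * (v : ZMod q) ^ 2) * hwv
      - (F.a : ZMod q) ^ 2 * hF0
  rcases mul_eq_zero.mp key with h | h
  · exact h
  · exact absurd (pow_eq_zero_iff (by norm_num) |>.mp h) hv

/-- **`a u + v ω ∈ (q, ω + c)`**: `a u + v ω = v (ω + c) + (a u − v c)` with `q ∣ a u − v c`. -/
theorem planeElt_mem_primeIdealAt : planeElt F u v ∈ primeIdealAt F q (residueAt F u v q) := by
  have hc := residueAt_mul_v hq hqa huv hqF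
  obtain ⟨k, hk⟩ : (q : ℤ) ∣ F.a * u - (residueAt F u v q : ℕ) * v := by
    rw [← ZMod.intCast_eq_intCast_iff_dvd_sub]
    push_cast at hc ⊢
    exact hc
  rw [primeIdealAt, Ideal.mem_span_pair]
  refine ⟨(k : RingOfForm F), (v : RingOfForm F), ?_⟩
  ext
  · simp [planeElt, RingOfForm.omega]; linarith
  · simp [planeElt, RingOfForm.omega]
  · simp [planeElt, RingOfForm.omega]

/-- **`(q, ω + c) ≤ (q, a u + v ω)`**: with `s v = 1 + q t` (as `q ∤ v`), `ω + c = s·(au + vω) + q·(k − tω)`. -/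
theorem primeIdealAt_le_span_pair :
    primeIdealAt F q (residueAt F u v q) ≤ Ideal.span {(q : RingOfForm F), planeElt F u v} := by
  haveI : Fact q.Prime := ⟨hq⟩
  have hv : ((v : ℤ) : ZMod q) ≠ 0 := by
    rw [Ne, ZMod.intCast_zmod_eq_zero_iff_dvd]; exact not_dvd_v_of_dvd_eval hq hqa huv hqF
  -- an integer inverse `s` of `v` mod `q`
  set s : ℤ := ((((v : ℤ) : ZMod q)⁻¹).val : ℤ) with hs
  have hs' : ((s : ℤ) : ZMod q) = ((v : ℤ) : ZMod q)⁻¹ := by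
    rw [hs, Int.cast_natCast, ZMod.natCast_zmod_val]
  obtain ⟨t, ht⟩ : (q : ℤ) ∣ s * v - 1 := by
    rw [← ZMod.intCast_eq_intCast_iff_dvd_sub]
    push_cast
    rw [hs', inv_mul_cancel₀ hv]
  have hc := residueAt_mul_v hq hqa huv hqF
  obtain ⟨k, hk⟩ : (q : ℤ) ∣ (residueAt F u v q : ℕ) - F.a * u * s := by
    rw [← ZMod.intCast_eq_intCast_iff_dvd_sub]
    push_cast at hc ⊢
    rw [hs', ← hc, mul_inv_cancel_right₀ hv]
  rw [primeIdealAt, Ideal.span_le]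
  rintro x (rfl | rfl)
  · exact Ideal.subset_span (by simp)
  · rw [SetLike.mem_coe, Ideal.mem_span_pair]
    refine ⟨(k : RingOfForm F) - (t : RingOfForm F) * omega F, (s : RingOfForm F), ?_⟩
    ext
    · simp [planeElt, RingOfForm.omega]; linarith
    · simp [planeElt, RingOfForm.omega]; linarith
    · simp [planeElt, RingOfForm.omega]

variable [hF : Fact F.IsIrreducible] [hM : Fact (RingOfForm.IsMaximal F)]

/-- **The prime of `(u, v)` at `q`**: `𝔓 = (q, ω + c)`, `c = au/v`, is prime of norm `q` and contains
`a u + v ω`; any prime ideal through `q` and `a u + v ω` equals it. -/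
theorem eq_primeIdealAt_of_mem {P : Ideal (RingOfForm F)} (hP : P.IsPrime) (hqP : (q : RingOfForm F) ∈ P)
    (hxP : planeElt F u v ∈ P) : P = primeIdealAt F q (residueAt F u v q) :=
  eq_primeIdealAt_of_le hq hqa (residueAt_mem_shapeRoots hq hqa huv hqF) hP
    ((primeIdealAt_le_span_pair hq hqa huv hqF).trans (by
      rw [Ideal.span_le]
      rintro x (rfl | rfl) <;> assumption))

end Plane

/-- **Degree-one primes on the plane** (registered sub-goal `exists_degree_one_prime` of stmt-ABC-1975): for an
irreducible maximal `F`, a prime `q ∤ a` dividing `F(u, v)` at a coprime `(u, v)` lies under a prime ideal of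
`R(F)` through `q` and `a u + v ω` with exactly `q` residue classes (the prime `(q, a u + v ω)` has degree one). -/
theorem exists_degree_one_prime : ∀ (F : BinaryCubic ℤ), F.IsIrreducible → RingOfForm.IsMaximal F → ∀ (q : ℕ) (u v : ℤ), q.Prime → ¬ (q : ℤ) ∣ F.a → IsCoprime u v → (q : ℤ) ∣ F.eval u v → ∃ P : Ideal (RingOfForm F), P.IsPrime ∧ (q : RingOfForm F) ∈ P ∧ planeElt F u v ∈ P ∧ Nat.card (RingOfForm F ⧸ P) = q := by
  intro F hirr hmax q u v hq hqa huv hqF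
  haveI : Fact F.IsIrreducible := ⟨hirr⟩
  haveI : Fact (RingOfForm.IsMaximal F) := ⟨hmax⟩
  have hroot := residueAt_mem_shapeRoots hq hqa huv hqF
  refine ⟨primeIdealAt F q (residueAt F u v q), isPrime_primeIdealAt hq hqa hroot, natCast_mem_primeIdealAt _ _,
    planeElt_mem_primeIdealAt hq hqa huv hqF, ?_⟩
  have h := absNorm_primeIdealAt hq hqa hroot
  rwa [Ideal.absNorm_apply, Submodule.cardQuot_apply] at h

/-! ## 3. At most three shape roots at a prime -/

/-- **At most three shape roots**: `c ↦ −c (mod q)` embeds `shapeRoots F q` into the roots of the cubic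
`W³ − bW² + acW − a²d` over the field `ℤ/q` (registered sub-goal `card_shapeRoots_le_three` of stmt-ABC-1975). -/
theorem card_shapeRoots_le_three : ∀ (F : BinaryCubic ℤ) (q : ℕ), q.Prime → (shapeRoots F q).card ≤ 3 := by
  intro F q hq
  classical
  haveI : Fact q.Prime := ⟨hq⟩
  set P : Cubic (ZMod q) := ⟨1, -(F.b : ZMod q), (F.a : ZMod q) * F.c, -((F.a : ZMod q) ^ 2 * F.d)⟩ with hP
  have hP0 : P.toPoly ≠ 0 := Cubic.ne_zero_of_a_ne_zero (by simp [hP])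
  have hmaps : ∀ c ∈ shapeRoots F q, -(c : ZMod q) ∈ P.roots.toFinset := by
    intro c hc
    rw [Multiset.mem_toFinset, Cubic.mem_roots_iff hP0]
    have h := (mem_shapeRoots.mp hc).2
    simp only [hP]
    linear_combination h
  have hinj : Set.InjOn (fun c : ℕ => -(c : ZMod q)) (shapeRoots F q) := by
    intro c₁ h₁ c₂ h₂ h
    have h₁' := (mem_shapeRoots.mp h₁).1
    have h₂' := (mem_shapeRoots.mp h₂).1
    have : (c₁ : ZMod q) = (c₂ : ZMod q) := neg_injective h
    rw [ZMod.natCast_eq_natCast_iff', Nat.mod_eq_of_lt h₁', Nat.mod_eq_of_lt h₂'] at this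
    exact this
  calc (shapeRoots F q).card ≤ P.roots.toFinset.card := Finset.card_le_card_of_injOn _ hmaps hinj
    _ ≤ 3 := Cubic.card_roots_le

end Summit.ABC.ABC.Theorems.SharpModerateLaw.UnitPlane

end
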